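import Literature.AnabelianGeometry.AbsoluteAnabelian.AbsAnabUnitsTransportUnique
import Literature.AnabelianGeometry.AbsoluteAnabelian.AbsAnabUnitsTransportHolds
import Literature.NumberTheory.GaloisRepresentations.MaxUnramifiedIntegers
import HarnessLib

/-!
# [AbsAnab] Prop. 1.2.1 (vi)/(vii): the units transport `ψ̄ : K̄₁^× ⥲ K̄₂^×` under an INNER twist of `G_{K₂}`
# (proof-only companion of rows L02 `UnitsTransport` / `unitsTransport_unique`)

S. Mochizuki, *The Absolute Anabelian Geometry of Hyperbolic Curves* (2004) [AbsAnab], §1.2, Prop. 1.2.1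
(vi)/(vii) pp. 10–11 [cite: MochizukiAbsAnab2004, Prop 1.2.1 (vi) p.10]: "(vi) The morphisms induced by `α` …
are Galois-equivariant with respect to `α`"; the isomorphism `α : G_{K₁} ⥲ G_{K₂}` of the proposition is used, in
[FrdII] Thm. 2.4, only through an OUTER isomorphism ("an outer isomorphism of topological groups `G₁ ⥲ G₂`",
[FrdII] p. 19 [cite: MochizukiFrdII2008, Thm 2.4 (i) p.19]), i.e. up to replacing `α` by `Inn(δ) ∘ α`, `δ ∈ G_{K₂}`.

WHY THIS FILE (cell abc-iut, row «T24ii-JUNCTION» of `plan/L1/SUBDAG-FrdII-Thm24.md`, seat abc-iut-L1-t7 gen 7,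
piece F2). The two representatives of `G₁ ⥲ G₂` that the cell's Theorem 2.4 (ii) closer must compare —
abc-iut-w5-d229's `α` (`BaseGaloisSystem.exists_pairIso_unitsTransport_padic`) and abc-iut-L1-t7's context-isomorphism
representative `isoGOfTheta` — differ by exactly such an inner twist (`isoGOfTheta = galConjBase₁ ≫ imEquiv θ ≫
innerConj(φ₂ c) ≫ galConjBase₂⁻¹`). This file records, in HYPOTHESIS form (no definitions), how the three properties of
rows L02/(vi)(vii) and THE units transport move under `α ↦ α'` with `α' σ = δ · α σ · δ⁻¹` and `ψ̄ ↦ δ • ψ̄`: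
* `IsAlphaEquivariant.innerTwist`, `PreservesAbsUnits.innerTwist` (Galois-stability of `𝒪_{K̄₂}`, the tree's
  `smul_mem_absIntegers`), `PreservesUniformizers.innerTwist` (`δ` fixes `K₂`);
* `unitsTransport_innerTwist` — THE (`unitsTransport_unique`) `α'`-transport is `δ •` THE `α`-transport;
* `exists_unitsTransport_innerTwist` — existence for `α'` in the twisted form, from `unitsTransport_holds` (abc-iut-L4-d3).
Classical local-field bookkeeping over landed files; nothing here concerns [IUTchIII] Cor. 3.12.
-/

namespace Literature.AnabelianGeometry.AbsoluteAnabelian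

namespace Prop121vii

open Field ValuativeRel
open scoped ValuativeRel
open Literature.NumberTheory.GaloisRepresentations

universe u

section Equivariance

variable {K₁ K₂ : Type u} [Field K₁] [Field K₂]
  {α α' : absoluteGaloisGroup K₁ ≃ₜ* absoluteGaloisGroup K₂} (δ : absoluteGaloisGroup K₂)
  (hα' : ∀ σ, α' σ = δ * α σ * δ⁻¹)

include hα' in
/-- **Equivariance under an inner twist**: if `ψ̄` is `α`-equivariant and `α' = Inn(δ) ∘ α`, then `δ • ψ̄` is
`α'`-equivariant: `δ·ψ̄(σ x) = δ·α(σ)·ψ̄(x) = (δ α(σ) δ⁻¹)·(δ·ψ̄ x)`. [cite: MochizukiAbsAnab2004, Prop 1.2.1 (vi) p.10] -/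
theorem IsAlphaEquivariant.innerTwist {ψ : (AlgebraicClosure K₁)ˣ ≃* (AlgebraicClosure K₂)ˣ}
    (hψ : IsAlphaEquivariant α ψ) :
    IsAlphaEquivariant α' (ψ.trans (MulDistribMulAction.toMulEquiv (AlgebraicClosure K₂)ˣ δ)) := by
  intro σ x
  simp only [MulEquiv.trans_apply, MulDistribMulAction.toMulEquiv_apply]
  rw [hψ, hα', mul_smul, inv_smul_smul, mul_smul]

include hα' in
/-- Conversely `α σ = δ⁻¹ · α' σ · δ`, so the twist is undone by `δ⁻¹`. [cite: MochizukiAbsAnab2004, Prop 1.2.1 (vi) p.10] -/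
theorem innerTwist_symm (σ : absoluteGaloisGroup K₁) : α σ = δ⁻¹ * α' σ * δ⁻¹⁻¹ := by
  rw [hα', inv_inv]
  group

end Equivariance

section Units

variable {K₁ K₂ : Type u} [Field K₁] [ValuativeRel K₁] [TopologicalSpace K₁] [IsNonarchimedeanLocalField K₁]
  [Field K₂] [ValuativeRel K₂] [TopologicalSpace K₂] [IsNonarchimedeanLocalField K₂] (δ : absoluteGaloisGroup K₂)

omit [TopologicalSpace K₂] [IsNonarchimedeanLocalField K₂] in
/-- `𝒪_{K̄₂}` (the integral closure `absIntegers 𝒪[K₂] K₂`) is stable under `G_{K₂}`, as an `iff`.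
[cite: MochizukiAbsAnab2004, Prop 1.2.1 (iii) p.10] -/
theorem smul_mem_absIntegers_iff (y : AlgebraicClosure K₂) :
    δ • y ∈ absIntegers 𝒪[K₂] K₂ ↔ y ∈ absIntegers 𝒪[K₂] K₂ := by
  refine ⟨fun h => ?_, fun h => IsNonarchimedeanLocalField.smul_mem_absIntegers δ h⟩
  have h' := IsNonarchimedeanLocalField.smul_mem_absIntegers δ⁻¹ h
  rwa [inv_smul_smul] at h'

omit [TopologicalSpace K₁] [IsNonarchimedeanLocalField K₁] [TopologicalSpace K₂] [IsNonarchimedeanLocalField K₂] in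
/-- **Units under an inner twist**: `δ • ψ̄` maps `𝒪^×_{K̄₁}` onto `𝒪^×_{K̄₂}` iff `ψ̄` does (`𝒪_{K̄₂}` is `G_{K₂}`-stable).
[cite: MochizukiAbsAnab2004, Prop 1.2.1 (iii) p.10] -/
theorem PreservesAbsUnits.innerTwist {ψ : (AlgebraicClosure K₁)ˣ ≃* (AlgebraicClosure K₂)ˣ}
    (hψ : PreservesAbsUnits ψ) :
    PreservesAbsUnits (ψ.trans (MulDistribMulAction.toMulEquiv (AlgebraicClosure K₂)ˣ δ)) := by
  intro x
  rw [hψ x]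
  simp only [MulEquiv.trans_apply, MulDistribMulAction.toMulEquiv_apply, Units.coe_smul, Units.coe_inv_smul]
  rw [smul_mem_absIntegers_iff, smul_mem_absIntegers_iff]

/-- **Uniformisers under an inner twist**: `δ ∈ G_{K₂}` fixes `K₂ ⊆ K̄₂` pointwise, so `δ • ψ̄` still carries
uniformisers of `K₁` to (the same) uniformisers of `K₂`. [cite: MochizukiAbsAnab2004, Prop 1.2.1 (iv) p.10] -/
theorem PreservesUniformizers.innerTwist {ψ : (AlgebraicClosure K₁)ˣ ≃* (AlgebraicClosure K₂)ˣ}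
    (hψ : PreservesUniformizers ψ) :
    PreservesUniformizers (ψ.trans (MulDistribMulAction.toMulEquiv (AlgebraicClosure K₂)ˣ δ)) := by
  intro π₁ hπ₁
  obtain ⟨π₂, hπ₂, hψπ⟩ := hψ π₁ hπ₁
  refine ⟨π₂, hπ₂, ?_⟩
  rw [MulEquiv.trans_apply, MulDistribMulAction.toMulEquiv_apply, hψπ]
  apply Units.ext
  rw [Units.coe_smul, Units.coe_map, MonoidHom.coe_coe, absoluteGaloisGroup.smul_def, AlgEquiv.commutes]

end Units

section Transport

variable {K₁ K₂ : Type u} [Field K₁] [ValuativeRel K₁] [TopologicalSpace K₁] [IsNonarchimedeanLocalField K₁]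
  [Field K₂] [ValuativeRel K₂] [TopologicalSpace K₂] [IsNonarchimedeanLocalField K₂] [CharZero K₂]
  {α α' : absoluteGaloisGroup K₁ ≃ₜ* absoluteGaloisGroup K₂} (δ : absoluteGaloisGroup K₂)
  (hα' : ∀ σ, α' σ = δ * α σ * δ⁻¹)

include hα' in
/-- **THE units transport under an inner twist.** If `ψ̄₀` is the `α`-equivariant, uniformiser-preserving transport
(row L02; unique by `unitsTransport_unique`) and `ψ̄₀'` the one for `α' = Inn(δ) ∘ α`, then `ψ̄₀' = δ • ψ̄₀`.
[cite: MochizukiAbsAnab2004, Prop 1.2.1 (vii) p.11] -/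
theorem unitsTransport_innerTwist {ψ₀ ψ₀' : (AlgebraicClosure K₁)ˣ ≃* (AlgebraicClosure K₂)ˣ}
    (h₀ : IsAlphaEquivariant α ψ₀) (hU₀ : PreservesUniformizers ψ₀) (h₀' : IsAlphaEquivariant α' ψ₀')
    (hU₀' : PreservesUniformizers ψ₀') :
    ψ₀' = ψ₀.trans (MulDistribMulAction.toMulEquiv (AlgebraicClosure K₂)ˣ δ) :=
  unitsTransport_unique (h₀.innerTwist δ hα') h₀' (hU₀.innerTwist δ) hU₀'

include hα' in
/-- … pointwise: `ψ̄₀' x = δ • ψ̄₀ x`. [cite: MochizukiAbsAnab2004, Prop 1.2.1 (vii) p.11] -/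
theorem unitsTransport_innerTwist_apply {ψ₀ ψ₀' : (AlgebraicClosure K₁)ˣ ≃* (AlgebraicClosure K₂)ˣ}
    (h₀ : IsAlphaEquivariant α ψ₀) (hU₀ : PreservesUniformizers ψ₀) (h₀' : IsAlphaEquivariant α' ψ₀')
    (hU₀' : PreservesUniformizers ψ₀') (x : (AlgebraicClosure K₁)ˣ) :
    ψ₀' x = δ • ψ₀ x := by
  rw [unitsTransport_innerTwist δ hα' h₀ hU₀ h₀' hU₀']
  rfl

include hα' in
/-- **An `α'`-equivariant `ψ̄` preserving uniformisers is `δ •` THE `α`-transport**, and then automatically maps units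
to units — the form in which the Theorem 2.4 (ii) junction consumes rigidity: any `ψ̄` that is equivariant for the
twisted representative and oriented agrees with `δ • ψ̄₀`. [cite: MochizukiAbsAnab2004, Prop 1.2.1 (vii) p.11] -/
theorem IsAlphaEquivariant.eq_innerTwist {ψ₀ ψ : (AlgebraicClosure K₁)ˣ ≃* (AlgebraicClosure K₂)ˣ}
    (h₀ : IsAlphaEquivariant α ψ₀) (hU₀ : PreservesUniformizers ψ₀) (hψ : IsAlphaEquivariant α' ψ)
    (hU : PreservesUniformizers ψ) (x : (AlgebraicClosure K₁)ˣ) : ψ x = δ • ψ₀ x :=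
  unitsTransport_innerTwist_apply δ hα' h₀ hU₀ hψ hU x

end Transport

section Existence

variable {K₁ K₂ : Type} [Field K₁] [ValuativeRel K₁] [TopologicalSpace K₁] [IsNonarchimedeanLocalField K₁]
  [CharZero K₁] [Field K₂] [ValuativeRel K₂] [TopologicalSpace K₂] [IsNonarchimedeanLocalField K₂] [CharZero K₂]
  {α α' : absoluteGaloisGroup K₁ ≃ₜ* absoluteGaloisGroup K₂} (δ : absoluteGaloisGroup K₂)
  (hα' : ∀ σ, α' σ = δ * α σ * δ⁻¹)

include hα' in
/-- **Row L02 in twisted form.** For `α' = Inn(δ) ∘ α` there is `ψ̄₀` which is `α`-equivariant, unit- and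
uniformiser-preserving, such that `δ • ψ̄₀` is `α'`-equivariant, unit- and uniformiser-preserving — and every
`α'`-equivariant uniformiser-preserving `ψ̄` IS `δ • ψ̄₀` (abc-iut-L4-d3's `unitsTransport_holds` + the lemmas above).
[cite: MochizukiAbsAnab2004, Prop 1.2.1 (vii) p.11] -/
theorem exists_unitsTransport_innerTwist :
    ∃ ψ₀ : (AlgebraicClosure K₁)ˣ ≃* (AlgebraicClosure K₂)ˣ,
      (IsAlphaEquivariant α ψ₀ ∧ PreservesAbsUnits ψ₀ ∧ PreservesUniformizers ψ₀) ∧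
      (IsAlphaEquivariant α' (ψ₀.trans (MulDistribMulAction.toMulEquiv (AlgebraicClosure K₂)ˣ δ)) ∧
        PreservesAbsUnits (ψ₀.trans (MulDistribMulAction.toMulEquiv (AlgebraicClosure K₂)ˣ δ)) ∧
        PreservesUniformizers (ψ₀.trans (MulDistribMulAction.toMulEquiv (AlgebraicClosure K₂)ˣ δ))) ∧
      ∀ ψ : (AlgebraicClosure K₁)ˣ ≃* (AlgebraicClosure K₂)ˣ, IsAlphaEquivariant α' ψ → PreservesUniformizers ψ →
        ∀ x, ψ x = δ • ψ₀ x := by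
  obtain ⟨ψ₀, h₀, hu₀, hU₀⟩ := unitsTransport_holds K₁ K₂ α
  exact ⟨ψ₀, ⟨h₀, hu₀, hU₀⟩, ⟨h₀.innerTwist δ hα', hu₀.innerTwist δ, hU₀.innerTwist δ⟩,
    fun ψ hψ hU x => h₀.eq_innerTwist δ hα' hU₀ hψ hU x⟩

end Existence

end Prop121vii

end Literature.AnabelianGeometry.AbsoluteAnabelian
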